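import Summits.QuantumFields.BalabanUV.Beta.DiagonalContact
import Summits.QuantumFields.BalabanUV.Beta.LambdaPieceReflection

/-!
# The vh-PIECE of the native-placement spine obeys (Sr) WITH THE DIAGONAL CONTACT: the socket shape
# `S κ′ (bref α κ′ u) = ε_{κ′} • refK Φ (S κ′ u + conjV (bhKAt ρ_c Lc) C)` with `C = (cVH/Lc^{d+1}) • diagK (ctGen α Lc κ′ u)`
# (β sub-cell, row BETA-an2, gen 14; NOTE X-an2-45 §3 (i)–(ii), AN2 §40.5 item (2): the second input of hSrC at `j = 0`)

HONEST FRAMING (cell charter, verbatim): «discharging BetaPertH makes Balaban's UV stability UNCONDITIONAL — a real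
constructive-QFT result; it is NOT the continuum limit and NOT the Clay problem.»  DERIVED cell leaf (pub-balaban β sub-cell, lane
an2 gen 14); no statement of Bałaban's papers is typed here, no `[cite:]` tag, no `Prop` fact; it instantiates no binder of the
β-function wall by itself.  NOT `BetaPertH`; NOT continuum; NOT Clay.

## What is here ([folklore]; an5's `vhSAt_bref` + an2's `DiagonalContact` identity assembled in the socket's currency)

* §1 `conjV_smul_right : conjV M (c • X) = c • conjV M X` (an5's `comp_smul_left/right`).
* §2 BLOCKWISE, every jet bond: `S0NAt_vh_bref_inl_inr` / `_inr_inl` — on the field–multiplier blocks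
  `(cVH • vhSAt ρ_c) κ′ (bref α κ′ u) = ε_{κ′} • refK Φ ((cVH • vhSAt ρ_c) κ′ u + conjV (bhKAt ρ_c Lc) ((cVH/Lc^{d+1}) • diagK (ctGen α Lc κ′ u)))`
  read entrywise (`S0NAt ρ_c 0 cVH 0` is the vh-slice of the native spine); the diagonal blocks of the vh-slice vanish on both sides.
* §3 **`S0NAt_vh_bref_of_ne`** (jet bond NOT parallel to the reflected axis, `κ′ ≠ α`): the full kernel identity
  `S0NAt ρ_c 0 cVH 0 κ′ (bref α κ′ u) = ε_{κ′} • refK (Φ Lc α) (S0NAt ρ_c 0 cVH 0 κ′ u + conjV (bhKAt d ρ_c Lc) ((cVH / Lc^{d+1}) • diagK (ctGen d α Lc κ′ u)))`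
  — EXACTLY the shape of the hypothesis hSrC of `SpineRooted.axisReflectionCovariant_flipK_TbalOf_JsBalBmAtOf_ctrC` for this slice, with
  the `axEc`-commuting diagonal contact of `DiagonalContact` (for `κ′ = α` the same contact also carries the field–field block
  `conjV_bhKAt_ctGen_inl_inl`, which the Wilson piece must absorb — an3's table, open); and **`S0NAt_vhLam_bref_of_ne`**: the same for
  the vh+Λ slice `S0NAt ρ_c 0 cVH cΛ` (the Λ-piece contributes no contact, `LambdaPieceReflection`).

All declarations `[folklore]`; axioms standard.  Provenance: b2b-balaban β sub-cell, unit beta-an2 gen 14, 2026-08-20 (v1); over an5's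
`RootedKernelReflection.vhSAt_bref`, an2's `DiagonalContact`/`SpineRootedS0N`/`LambdaPieceReflection` BY NAME; no existing file touched.
-/

open Finset
open scoped BigOperators
open Literature.Probability.LatticeModels (Torus.proj)
open Literature.MathematicalPhysics.QuantumFieldTheory
open Literature.MathematicalPhysics.QuantumFieldTheory.Balaban1983to89
open Literature.MathematicalPhysics.QuantumFieldTheory.Balaban1983to89.Beta
open ExpKernelCalculus (MKer comp)
open AveragingContoursRooted (ctr ctrOff)
open AveragingHessianKernels (packVH packVH_inl_inl packVH_inr_inr packVH_inl_inr packVH_inr_inl)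
open AveragingHessianKernelsRooted (vhSAt)
open RootedKernelReflection (ctE vhSAt_bref)
open PolarizationSign (reflSign)
open KernelReflection (LegMap refK refK_apply comp_smul_left comp_smul_right)
open ResolventReflection (bref Φ Φ_r_inl Φ_r_inr Φ_s_inl Φ_s_inr)
open OneStepResolventKernel (Fib)
open Summit.QuantumFields.BalabanUV.Beta.ChartConjugation (conjV)
open Summit.QuantumFields.BalabanUV.Beta.BorderedHessian (bhKAt diagK ctGen conjV_bhKAt_ctGen_inl_inr conjV_bhKAt_ctGen_inr_inl
  conjV_bhKAt_ctGen_inr_inr conjV_bhKAt_ctGen_inl_inl_of_ne)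

noncomputable section

namespace Summit.QuantumFields.BalabanUV.Beta.SpineRooted

variable {d : ℕ}

/-! ## §1 The contact is linear in the generator -/

/-- [folklore] `conjV M (c • X) = c • conjV M X`. -/
theorem conjV_smul_right (M X : MKer (d + 1) (Fib d)) (c : ℝ) : conjV M (c • X) = c • conjV M X := by
  unfold ChartConjugation.conjV
  rw [KernelReflection.comp_smul_right, KernelReflection.comp_smul_left, smul_sub]

/-! ## §2 The vh-slice at a reflected jet bond, blockwise -/

section Blocks

variable {Lc : ℕ} [NeZero Lc]

/-- [folklore] The vh-slice of the native spine at the centred root, entrywise. -/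
theorem S0NAt_vh_ctr_apply (cVH : ℝ) (κ' : Fin (d + 1)) (u x z : Fin (d + 1) → ℤ) (a b : Fib d) :
    S0NAt d Lc (ctr (d + 1) Lc) 0 cVH 0 κ' u x z a b = cVH * vhSAt (ctr (d + 1) Lc) d Lc rfl κ' u x z a b :=
  S0NAt_vh_apply d Lc _ cVH κ' u x z a b

/-- [folklore] **FIELD–MULTIPLIER BLOCK** of the conjugated (Sr) law for the vh-slice (every jet bond). -/
theorem S0NAt_vh_bref_inl_inr (hLc : Odd Lc) (cVH : ℝ) (α κ' : Fin (d + 1)) (u x z : Fin (d + 1) → ℤ) (β μ : Fin (d + 1)) :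
    S0NAt d Lc (ctr (d + 1) Lc) 0 cVH 0 κ' (bref α κ' u) x z (Sum.inl β) (Sum.inr μ) =
      (reflSign α κ' • refK (Φ Lc α) (S0NAt d Lc (ctr (d + 1) Lc) 0 cVH 0 κ' u +
        conjV (bhKAt d (ctr (d + 1) Lc) Lc) ((cVH / (Lc : ℝ) ^ (d + 1)) • diagK (ctGen d α Lc κ' u)))) x z (Sum.inl β) (Sum.inr μ) := by
  have hL : ((Lc : ℝ) ^ (d + 1)) ≠ 0 := pow_ne_zero _ (by exact_mod_cast NeZero.ne Lc)
  rw [S0NAt_vh_ctr_apply, vhSAt_bref hLc]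
  simp only [Pi.smul_apply, Pi.add_apply, Pi.sub_apply, smul_eq_mul, refK_apply, S0NAt_vh_ctr_apply, conjV_smul_right,
    Φ_r_inl, Φ_r_inr, conjV_bhKAt_ctGen_inl_inr]
  field_simp
  ring

/-- [folklore] **MULTIPLIER–FIELD BLOCK** of the conjugated (Sr) law for the vh-slice (every jet bond). -/
theorem S0NAt_vh_bref_inr_inl (hLc : Odd Lc) (cVH : ℝ) (α κ' : Fin (d + 1)) (u x z : Fin (d + 1) → ℤ) (μ β : Fin (d + 1)) :
    S0NAt d Lc (ctr (d + 1) Lc) 0 cVH 0 κ' (bref α κ' u) x z (Sum.inr μ) (Sum.inl β) =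
      (reflSign α κ' • refK (Φ Lc α) (S0NAt d Lc (ctr (d + 1) Lc) 0 cVH 0 κ' u +
        conjV (bhKAt d (ctr (d + 1) Lc) Lc) ((cVH / (Lc : ℝ) ^ (d + 1)) • diagK (ctGen d α Lc κ' u)))) x z (Sum.inr μ) (Sum.inl β) := by
  have hL : ((Lc : ℝ) ^ (d + 1)) ≠ 0 := pow_ne_zero _ (by exact_mod_cast NeZero.ne Lc)
  rw [S0NAt_vh_ctr_apply, vhSAt_bref hLc]
  simp only [Pi.smul_apply, Pi.add_apply, Pi.sub_apply, smul_eq_mul, refK_apply, S0NAt_vh_ctr_apply, conjV_smul_right,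
    Φ_r_inl, Φ_r_inr, conjV_bhKAt_ctGen_inr_inl]
  field_simp
  ring

/-- [folklore] MULTIPLIER–MULTIPLIER BLOCK: both sides vanish. -/
theorem S0NAt_vh_bref_inr_inr (hLc : Odd Lc) (cVH : ℝ) (α κ' : Fin (d + 1)) (u x z : Fin (d + 1) → ℤ) (μ μ' : Fin (d + 1)) :
    S0NAt d Lc (ctr (d + 1) Lc) 0 cVH 0 κ' (bref α κ' u) x z (Sum.inr μ) (Sum.inr μ') =
      (reflSign α κ' • refK (Φ Lc α) (S0NAt d Lc (ctr (d + 1) Lc) 0 cVH 0 κ' u +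
        conjV (bhKAt d (ctr (d + 1) Lc) Lc) ((cVH / (Lc : ℝ) ^ (d + 1)) • diagK (ctGen d α Lc κ' u)))) x z (Sum.inr μ) (Sum.inr μ') := by
  rw [S0NAt_vh_ctr_apply, vhSAt_bref hLc]
  simp only [Pi.smul_apply, Pi.add_apply, Pi.sub_apply, smul_eq_mul, refK_apply, S0NAt_vh_ctr_apply, conjV_smul_right,
    Φ_r_inr, conjV_bhKAt_ctGen_inr_inr, AveragingHessianKernelsRooted.vhSAt, packVH_inr_inr, mul_zero, sub_zero, add_zero]

/-- [folklore] FIELD–FIELD BLOCK for a jet bond NOT parallel to the reflected axis: both sides vanish. -/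
theorem S0NAt_vh_bref_inl_inl_of_ne (hLc : Odd Lc) (cVH : ℝ) {α κ' : Fin (d + 1)} (h : κ' ≠ α) (u x z : Fin (d + 1) → ℤ)
    (β β' : Fin (d + 1)) :
    S0NAt d Lc (ctr (d + 1) Lc) 0 cVH 0 κ' (bref α κ' u) x z (Sum.inl β) (Sum.inl β') =
      (reflSign α κ' • refK (Φ Lc α) (S0NAt d Lc (ctr (d + 1) Lc) 0 cVH 0 κ' u +
        conjV (bhKAt d (ctr (d + 1) Lc) Lc) ((cVH / (Lc : ℝ) ^ (d + 1)) • diagK (ctGen d α Lc κ' u)))) x z (Sum.inl β) (Sum.inl β') := by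
  rw [S0NAt_vh_ctr_apply, vhSAt_bref hLc]
  simp only [Pi.smul_apply, Pi.add_apply, Pi.sub_apply, smul_eq_mul, refK_apply, S0NAt_vh_ctr_apply, conjV_smul_right,
    Φ_r_inl, conjV_bhKAt_ctGen_inl_inl_of_ne _ _ _ _ h, AveragingHessianKernelsRooted.vhSAt, packVH_inl_inl, mul_zero, sub_zero, add_zero]

end Blocks

/-! ## §3 The socket shape for jet bonds off the reflected axis -/

section Socket

variable {Lc : ℕ} [NeZero Lc]

/-- [folklore] **(Sr-conj) FOR THE vh-SLICE OF THE NATIVE SPINE, JET BOND OFF THE REFLECTED AXIS** (`κ′ ≠ α`, centred root, `Lc` odd):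
the exact socket shape with the diagonal, `axEc`-commuting contact `C := (cVH / Lc^{d+1}) • diagK (ctGen α Lc κ′ u)` against the ROOTED
bordered Hessian `bhKAt ρ_c Lc`. -/
theorem S0NAt_vh_bref_of_ne (hLc : Odd Lc) (cVH : ℝ) {α κ' : Fin (d + 1)} (h : κ' ≠ α) (u : Fin (d + 1) → ℤ) :
    S0NAt d Lc (ctr (d + 1) Lc) 0 cVH 0 κ' (bref α κ' u) =
      reflSign α κ' • refK (Φ Lc α) (S0NAt d Lc (ctr (d + 1) Lc) 0 cVH 0 κ' u +
        conjV (bhKAt d (ctr (d + 1) Lc) Lc) ((cVH / (Lc : ℝ) ^ (d + 1)) • diagK (ctGen d α Lc κ' u))) := by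
  funext x z a b
  rcases a with β | μ <;> rcases b with β' | μ'
  · exact S0NAt_vh_bref_inl_inl_of_ne hLc cVH h u x z β β'
  · exact S0NAt_vh_bref_inl_inr hLc cVH α κ' u x z β μ'
  · exact S0NAt_vh_bref_inr_inl hLc cVH α κ' u x z μ β'
  · exact S0NAt_vh_bref_inr_inr hLc cVH α κ' u x z μ μ'

/-- [folklore] **THE vh+Λ SLICE** `S0NAt ρ_c 0 cVH cΛ` obeys the same socket shape for `κ′ ≠ α` (the Λ-piece contributes no contact). -/
theorem S0NAt_vhLam_bref_of_ne (hLc : Odd Lc) (cVH cΛ : ℝ) {α κ' : Fin (d + 1)} (h : κ' ≠ α) (u : Fin (d + 1) → ℤ) :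
    S0NAt d Lc (ctr (d + 1) Lc) 0 cVH cΛ κ' (bref α κ' u) =
      reflSign α κ' • refK (Φ Lc α) (S0NAt d Lc (ctr (d + 1) Lc) 0 cVH cΛ κ' u +
        conjV (bhKAt d (ctr (d + 1) Lc) Lc) ((cVH / (Lc : ℝ) ^ (d + 1)) • diagK (ctGen d α Lc κ' u))) := by
  have hsplit : ∀ w, S0NAt d Lc (ctr (d + 1) Lc) 0 cVH cΛ κ' w = S0NAt d Lc (ctr (d + 1) Lc) 0 cVH 0 κ' w +
      S0NAt d Lc (ctr (d + 1) Lc) 0 0 cΛ κ' w := by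
    intro w
    have e := congrFun (congrFun (S0NAt_split d Lc (ctr (d + 1) Lc) 0 cVH cΛ) κ') w
    simpa using e
  rw [hsplit, hsplit u, S0NAt_vh_bref_of_ne hLc cVH h u, S0NAt_lam_reflect hLc cΛ α κ' u]
  funext x z a b
  simp only [Pi.smul_apply, Pi.add_apply, smul_eq_mul, refK_apply]
  ring

end Socket

end Summit.QuantumFields.BalabanUV.Beta.SpineRooted

end
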